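import Literature.AlgebraicGeometry.HodgeTheory.MaxRationalSubHodgeStructureKunnethLevelOnePieces
import Literature.AlgebraicGeometry.HodgeTheory.GeneralHodgePropertyOffDiagonalWindow
import HarnessLib

/-!
# Grothendieck's level-one remark through hard Lefschetz and the coniveau window: the level-one cells that
# matter are `GHC(X, 2p+1, p)`, `1 ≤ p`, `2p + 1 ≤ dim X`; four- and fivefolds; the amended conjecture in every
# bidegree, granted `HC` on the products with curves, is its level-`≥ 2` window

Family `hodge`, layer `Literature/AlgebraicGeometry/HodgeTheory`; lane `lit-hodgefound` (Track 2 foundations,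
Layer A1/A4). THEOREMS ONLY (no definition, no named fact; D-0026). Sequel of
`MaxRationalSubHodgeStructureKunnethLevelOnePieces` (Grothendieck, Topology 8 (1969), p. 301: «for fixed `X` and
`p`, the [amended] Hodge conjecture [in degree `2p + 1`] is easily seen to be equivalent to the usual Hodge conjecture
in degree `2(p + 1)` for all products `C × X`, where `C` is a proper, smooth algebraic curve» — on the tree's carriers
`[∀ C : HC(X × C)] ⟺ HC(X) ∧ ∀ p, GHC(X, 2p+1, p)`, granted `levelOne_subHodge_eq_range_of_curve`, with `⟸`
unconditional) and of `GeneralHodgePropertyOffDiagonalWindow` (`∀ (i, r) : GHC(X, i, r)` iff the cells `1 ≤ r`,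
`2r < i ≤ dim X`, `i < dim X + r`).

What is proved (all from theorems of the tree; nothing new is assumed):

* §1 HARD LEFSCHETZ ON THE LEVEL-ONE CELLS. `GHC(X, 2p+1, p)` holds for `p = 0` (`r = 0`), for `p + 1 ≥ dim X`
  (`N^r Hⁱ = Hⁱ` for `i ≥ dim X + r`), and for `dim X < 2p + 1 < dim X + p` it is the hard-Lefschetz image of the
  cell `GHC(X, 2r' + 1, r')`, `r' = dim X − p − 1` (`generalHodgePropertyFor_of_add_eq_dim`, Voisin 2025 §4.3:
  «`Lʲ` induces an isomorphism of Hodge structures … compatible with the coniveau»). Hence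
  **`forall_generalHodgePropertyFor_levelOne_iff_le`**: `[∀ p : GHC(X, 2p+1, p)] ⟺ [∀ p, 1 ≤ p, 2p+1 ≤ dim X : GHC(X, 2p+1, p)]`,
  and the sharpened equivalence **`forall_hodgeConjectureFor_tensor_curve_iff_levelOne_le`**:
  `[∀ C : HC(X × C)] ⟺ HC(X) ∧ ∀ p (1 ≤ p, 2p + 1 ≤ dim X), GHC(X, 2p+1, p)` (granted the level-one fact), with the
  unconditional half `hodgeConjectureFor_tensor_curve_of_levelOne_le`.
* §2 SMALL DIMENSIONS. Fourfolds: `[∀ C : HC(X × C)] ⟺ GHC(X, 4, 2) ∧ GHC(X, 3, 1)` (`HC(X⁴) ⟺ GHC(4, 2)`, the one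
  level-one cell is `(3, 1)`); fivefolds: `⟺ GHC(X, 4, 2) ∧ GHC(X, 3, 1) ∧ GHC(X, 5, 2)`; both with unconditional `⟸`.
* §3 THE AMENDED CONJECTURE IN EVERY BIDEGREE, for `X` whose products with curves satisfy `HC` (and granted the
  level-one fact), is the level-`≥ 2` part of the off-diagonal window:
  **`forall_generalHodgePropertyFor_iff_levelTwo_window_of_forall_tensor_curve`**:
  `∀ (i, r) GHC(X, i, r) ⟺ ∀ (i, r), 1 ≤ r, 2r + 2 ≤ i ≤ dim X, i < dim X + r : GHC(X, i, r)`; fourfolds: `⟺ GHC(X, 4, 1)`;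
  fivefolds: `⟺ GHC(X, 4, 1) ∧ GHC(X, 5, 1)`.
* §4 `X × S`, `S` a surface, under the reduced level-one hypothesis: `HC(X × S) ⟺ HC(X) ∧` the transcendental
  pieces `H^{2p−2}(X) ⊠ T(S)_ℂ`.
* §5 `X × Y` under the reduced level-one hypotheses of BOTH factors: `HC(X × Y) ⟺ HC(X) ∧ HC(Y) ∧` the pieces
  `Hⁱ(X) ⊗ Hʲ(Y)` with `2 ≤ i ≤ 2 dim X − 2`, `2 ≤ j ≤ 2 dim Y − 2` (and small free coniveau).
* §6 SURFACES WITH `p_g = 0`, of any irregularity (ruled, bielliptic, …): `HC(X)` and the level-one cells of `X` give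
  `HC(X × S)`; for a threefold, `GHC(X, 3, 1)` gives `HC(X × S)`.
* §7 AN INSTANCE WHERE THE LEVEL-ONE CELL IS A THEOREM OF THE TREE: a threefold `X` whose `ℚ`-Hodge structure `H³(X)`
  is irreducible with `h^{3,0}(X) ≠ 0` has `J³(X)_alg = 0`, hence `GHC(X, 3, 1)` (Voisin I Thm. 12.21, the tree's
  `forall_generalHodgePropertyFor_dim_three_of_isIrreducible`); so `HC(X × C)` for every curve `C` and
  `HC(X × S)` for every surface `S` with `p_g(S) = 0` — unconditionally.

## References

* [GrothendieckTopology1969] A. Grothendieck, Hodge's general conjecture is false for trivial reasons, Topology 8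
  (1969) 299–303 — p. 300 (the amended statement, footnote on `i ≥ n + r`) and p. 301 (the level-one remark).
* [Voisin2025] C. Voisin, Hodge and generalized Hodge conjectures, coniveau and algebraic cycles, J. Open Math.
  Probl. 1 (2025), §4.1 Def. 4.1, §4.3 (hard Lefschetz and coniveau), §2.3 Lemma 2.9, §4.2 Prop. 4.8.
* [VoisinHodgeI2002] C. Voisin, Hodge Theory and Complex Algebraic Geometry I (CUP 2002), §6.2.3 Thm. 6.25,
  §11.3.3 Thm. 11.38, Lemma 11.41.
* [KerrPearlstein2016] M. Kerr, G. Pearlstein (eds.), Recent Advances in Hodge Theory (CUP 2016), Ch. 11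
  (S. Abdulali), Prop. 3.2 p. 291.
* [MurreTorino1994] J. P. Murre, Algebraic cycles and algebraic aspects of cohomology and K-theory (Torino
  lectures), §5.6–§5.8.
* [Voisin2013GHCBloch] C. Voisin, J. Algebraic Geom. 22 (2013), Lemma 2.1 (proof).
-/

noncomputable section

open CategoryTheory AlgebraicGeometry MonoidalCategory CartesianMonoidalCategory Finset
open Literature.AlgebraicTopology.SingularHomology
open Literature.Geometry.Kaehler
open Literature.AlgebraicGeometry.Motives (IsSmoothProjective ComplexPoints)

namespace Literature.AlgebraicGeometry.HodgeTheory

variable {n m : ℕ} {X Y : Motives.SchemeOver ℂ}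

/-! ### §1 Hard Lefschetz on the level-one cells -/

/-- **THE LEVEL-ONE CELLS REDUCE TO `1 ≤ p`, `2p + 1 ≤ dim X`**: if `GHC(X, 2q+1, q)` holds for all `q` with
`1 ≤ q` and `2q + 1 ≤ dim X`, it holds for every `p` — `p = 0` is coniveau `0`, `p + 1 ≥ dim X` is the free range
`i ≥ dim X + r`, and for `dim X < 2p + 1 < dim X + p` the cell is the image under `L^{2p+1−dim X}` of the cell
`(2(dim X − p − 1) + 1, dim X − p − 1)` (hard Lefschetz for `max`, `generalHodgePropertyFor_of_add_eq_dim`).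
[cite: Voisin2025, §4.3 (first paragraph)] [cite: GrothendieckTopology1969, p. 300] [cite: VoisinHodgeI2002, §6.2.3 Thm. 6.25] -/
theorem generalHodgePropertyFor_levelOne_of_forall_le (hX : IsSmoothProjective n X)
    (h : ∀ q : ℕ, 1 ≤ q → 2 * q + 1 ≤ n → GeneralHodgePropertyFor n X (2 * q + 1) q) (p : ℕ) :
    GeneralHodgePropertyFor n X (2 * p + 1) p := by
  rcases Nat.eq_zero_or_pos p with rfl | hp
  · exact generalHodgePropertyFor_of_not_window hX (Or.inl rfl)
  by_cases hle : 2 * p + 1 ≤ n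
  · exact h p hp hle
  by_cases hfree : n + p ≤ 2 * p + 1
  · exact generalHodgePropertyFor_of_not_window hX (Or.inr (Or.inr hfree))
  -- `n < 2p + 1 < n + p`: hard Lefschetz from the cell `(2r' + 1, r')`, `r' = n − p − 1 ≥ 1`
  obtain ⟨j, hj⟩ : ∃ j, 2 * p + 1 = n + j := ⟨2 * p + 1 - n, by omega⟩
  obtain ⟨r', rfl⟩ : ∃ r', p = r' + j := ⟨p - j, by omega⟩
  have h' := generalHodgePropertyFor_of_add_eq_dim hX (show (2 * r' + 1) + j = n by omega) (h r' (by omega) (by omega))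
  rwa [show 2 * r' + 1 + 2 * j = 2 * (r' + j) + 1 by omega] at h'

/-- **`[∀ p : GHC(X, 2p+1, p)] ⟺ [∀ p, 1 ≤ p, 2p + 1 ≤ dim X : GHC(X, 2p+1, p)]`.**
[cite: Voisin2025, §4.3 (first paragraph)] [cite: GrothendieckTopology1969, p. 300] -/
theorem forall_generalHodgePropertyFor_levelOne_iff_le (hX : IsSmoothProjective n X) :
    (∀ p : ℕ, GeneralHodgePropertyFor n X (2 * p + 1) p) ↔
      ∀ p : ℕ, 1 ≤ p → 2 * p + 1 ≤ n → GeneralHodgePropertyFor n X (2 * p + 1) p :=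
  ⟨fun h p _ _ ↦ h p, generalHodgePropertyFor_levelOne_of_forall_le hX⟩

/-- **GROTHENDIECK'S LEVEL-ONE REMARK, SHARPENED BY HARD LEFSCHETZ**: granted `levelOne_subHodge_eq_range_of_curve`,
`[∀ curves C : HC(X × C)] ⟺ HC(X) ∧ ∀ p (1 ≤ p, 2p + 1 ≤ dim X), GHC(X, 2p+1, p)`.
[cite: GrothendieckTopology1969, p. 301] [cite: KerrPearlstein2016, Ch. 11 (Abdulali) Prop. 3.2 p. 291]
[cite: Voisin2025, §4.3 (first paragraph)] -/
theorem forall_hodgeConjectureFor_tensor_curve_iff_levelOne_le (hR : levelOne_subHodge_eq_range_of_curve)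
    (hX : IsSmoothProjective n X) :
    (∀ ⦃C : Motives.SchemeOver ℂ⦄, IsSmoothProjective 1 C → HodgeConjectureFor (n + 1) (X ⊗ C)) ↔
      HodgeConjectureFor n X ∧ ∀ p : ℕ, 1 ≤ p → 2 * p + 1 ≤ n → GeneralHodgePropertyFor n X (2 * p + 1) p := by
  rw [forall_hodgeConjectureFor_tensor_curve_iff_levelOne hR hX, forall_generalHodgePropertyFor_levelOne_iff_le hX]

/-- **Unconditional half**: `HC(X)` and `GHC(X, 2p+1, p)` for `1 ≤ p`, `2p + 1 ≤ dim X` give `HC(X × C)` for every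
smooth projective curve `C`. [cite: GrothendieckTopology1969, pp. 300–301] [cite: Voisin2025, §4.3 (first paragraph)]
[cite: Voisin2013GHCBloch, Lemma 2.1 (proof)] -/
theorem hodgeConjectureFor_tensor_curve_of_levelOne_le (hX : IsSmoothProjective n X) (hC : IsSmoothProjective 1 Y)
    (hXc : HodgeConjectureFor n X)
    (hL : ∀ p : ℕ, 1 ≤ p → 2 * p + 1 ≤ n → GeneralHodgePropertyFor n X (2 * p + 1) p) :
    HodgeConjectureFor (n + 1) (X ⊗ Y) :=
  hodgeConjectureFor_tensor_curve_of_levelOne hX hC hXc fun c _ _ ↦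
    generalHodgePropertyFor_levelOne_of_forall_le hX hL c

/-! ### §2 Fourfolds and fivefolds -/

/-- **FOURFOLDS: `[∀ curves C : HC(X × C)] ⟺ GHC(X, 4, 2) ∧ GHC(X, 3, 1)`** (granted the level-one fact):
`HC(X⁴) ⟺ GHC(X, 4, 2)` (Lefschetz range elsewhere) and the only level-one cell with `2p + 1 ≤ 4`, `p ≥ 1` is
`(3, 1)`. [cite: GrothendieckTopology1969, p. 301] [cite: Voisin2025, §4.3] [cite: MurreTorino1994, §5.7 c] -/
theorem forall_hodgeConjectureFor_fourfold_tensor_curve_iff (hR : levelOne_subHodge_eq_range_of_curve)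
    (hX : IsSmoothProjective 4 X) :
    (∀ ⦃C : Motives.SchemeOver ℂ⦄, IsSmoothProjective 1 C → HodgeConjectureFor (4 + 1) (X ⊗ C)) ↔
      GeneralHodgePropertyFor 4 X (2 * 2) 2 ∧ GeneralHodgePropertyFor 4 X 3 1 := by
  rw [forall_hodgeConjectureFor_tensor_curve_iff_levelOne_le hR hX,
    hodgeConjectureFor_iff_generalHodgePropertyFor_four_two_of_dim_four hX]
  refine ⟨fun h ↦ ⟨h.1, ?_⟩, fun h ↦ ⟨h.1, fun p hp hpn ↦ ?_⟩⟩
  · have h1 := h.2 1 le_rfl (by omega)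
    rwa [show 2 * 1 + 1 = 3 from rfl] at h1
  · obtain rfl : p = 1 := by omega
    exact h.2

/-- **Fourfolds, unconditionally: `GHC(X, 4, 2) ∧ GHC(X, 3, 1) ⟹ HC(X × C)` for every curve `C`.**
[cite: GrothendieckTopology1969, p. 301] [cite: Voisin2013GHCBloch, Lemma 2.1 (proof)] -/
theorem hodgeConjectureFor_fourfold_tensor_curve (hX : IsSmoothProjective 4 X) (hC : IsSmoothProjective 1 Y)
    (h42 : GeneralHodgePropertyFor 4 X (2 * 2) 2) (h31 : GeneralHodgePropertyFor 4 X 3 1) :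
    HodgeConjectureFor (4 + 1) (X ⊗ Y) := by
  refine hodgeConjectureFor_tensor_curve_of_levelOne_le hX hC
    ((hodgeConjectureFor_iff_generalHodgePropertyFor_four_two_of_dim_four hX).2 h42) fun p hp hpn ↦ ?_
  obtain rfl : p = 1 := by omega
  exact h31

/-- **FIVEFOLDS: `[∀ curves C : HC(X × C)] ⟺ GHC(X, 4, 2) ∧ GHC(X, 3, 1) ∧ GHC(X, 5, 2)`** (granted the level-one
fact; `HC(X⁵) ⟺ GHC(4, 2)`, the level-one cells with `2p + 1 ≤ 5`, `p ≥ 1` are `(3, 1)`, `(5, 2)`).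
[cite: GrothendieckTopology1969, p. 301] [cite: Voisin2025, §4.3] -/
theorem forall_hodgeConjectureFor_fivefold_tensor_curve_iff (hR : levelOne_subHodge_eq_range_of_curve)
    (hX : IsSmoothProjective 5 X) :
    (∀ ⦃C : Motives.SchemeOver ℂ⦄, IsSmoothProjective 1 C → HodgeConjectureFor (5 + 1) (X ⊗ C)) ↔
      GeneralHodgePropertyFor 5 X (2 * 2) 2 ∧ GeneralHodgePropertyFor 5 X 3 1 ∧
        GeneralHodgePropertyFor 5 X 5 2 := by
  rw [forall_hodgeConjectureFor_tensor_curve_iff_levelOne_le hR hX,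
    hodgeConjectureFor_iff_generalHodgePropertyFor_four_two_of_dim_five hX]
  refine ⟨fun h ↦ ⟨h.1, ?_, ?_⟩, fun h ↦ ⟨h.1, fun p hp hpn ↦ ?_⟩⟩
  · have h1 := h.2 1 le_rfl (by omega)
    rwa [show 2 * 1 + 1 = 3 from rfl] at h1
  · have h2 := h.2 2 (by omega) (by omega)
    rwa [show 2 * 2 + 1 = 5 from rfl] at h2
  · rcases (show p = 1 ∨ p = 2 by omega) with rfl | rfl
    · exact h.2.1
    · exact h.2.2

/-- **Fivefolds, unconditionally: `GHC(X, 4, 2) ∧ GHC(X, 3, 1) ∧ GHC(X, 5, 2) ⟹ HC(X × C)` for every curve `C`.**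
[cite: GrothendieckTopology1969, p. 301] [cite: Voisin2013GHCBloch, Lemma 2.1 (proof)] -/
theorem hodgeConjectureFor_fivefold_tensor_curve (hX : IsSmoothProjective 5 X) (hC : IsSmoothProjective 1 Y)
    (h42 : GeneralHodgePropertyFor 5 X (2 * 2) 2) (h31 : GeneralHodgePropertyFor 5 X 3 1)
    (h52 : GeneralHodgePropertyFor 5 X 5 2) : HodgeConjectureFor (5 + 1) (X ⊗ Y) := by
  refine hodgeConjectureFor_tensor_curve_of_levelOne_le hX hC
    ((hodgeConjectureFor_iff_generalHodgePropertyFor_four_two_of_dim_five hX).2 h42) fun p hp hpn ↦ ?_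
  rcases (show p = 1 ∨ p = 2 by omega) with rfl | rfl
  · exact h31
  · exact h52

/-! ### §3 The amended conjecture in every bidegree, granted `HC` on the products with curves -/

/-- **THE LEVEL-`≥ 2` WINDOW**: granted `levelOne_subHodge_eq_range_of_curve`, for `X` all of whose products with
smooth projective curves satisfy the usual Hodge conjecture, Grothendieck's amended conjecture holds in EVERY
bidegree iff it holds on the cells `1 ≤ r`, `2r + 2 ≤ i ≤ dim X`, `i < dim X + r` (the off-diagonal lower window of
`forall_generalHodgePropertyFor_iff_offDiagonal_lower_window` with its level-one cells `i = 2r + 1` removed by the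
level-one remark). [cite: GrothendieckTopology1969, pp. 300–301] [cite: Voisin2025, §4.3]
[cite: KerrPearlstein2016, Ch. 11 (Abdulali) Prop. 3.2 p. 291] -/
theorem forall_generalHodgePropertyFor_iff_levelTwo_window_of_forall_tensor_curve
    (hR : levelOne_subHodge_eq_range_of_curve) (hX : IsSmoothProjective n X)
    (hC : ∀ ⦃C : Motives.SchemeOver ℂ⦄, IsSmoothProjective 1 C → HodgeConjectureFor (n + 1) (X ⊗ C)) :
    (∀ i r : ℕ, GeneralHodgePropertyFor n X i r) ↔
      ∀ i r : ℕ, 1 ≤ r → 2 * r + 2 ≤ i → i ≤ n → i < n + r → GeneralHodgePropertyFor n X i r := by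
  refine ⟨fun h i r _ _ _ _ ↦ h i r,
    fun h ↦ (forall_generalHodgePropertyFor_iff_offDiagonal_lower_window hX).2 fun i r hr h2 hi hw ↦ ?_⟩
  by_cases hlev : i = 2 * r + 1
  · subst hlev
    exact ((forall_hodgeConjectureFor_tensor_curve_iff_levelOne hR hX).1 hC).2 r
  · exact h i r hr (by omega) hi hw

/-- **Fourfolds: granted the level-one fact and `HC` on all `X × C`, the amended conjecture for `X` in every bidegree
is `GHC(X, 4, 1)`.** [cite: GrothendieckTopology1969, pp. 300–301] [cite: Voisin2025, §4.3] -/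
theorem forall_generalHodgePropertyFor_dim_four_iff_of_forall_tensor_curve (hR : levelOne_subHodge_eq_range_of_curve)
    (hX : IsSmoothProjective 4 X)
    (hC : ∀ ⦃C : Motives.SchemeOver ℂ⦄, IsSmoothProjective 1 C → HodgeConjectureFor (4 + 1) (X ⊗ C)) :
    (∀ i r : ℕ, GeneralHodgePropertyFor 4 X i r) ↔ GeneralHodgePropertyFor 4 X 4 1 := by
  rw [forall_generalHodgePropertyFor_iff_levelTwo_window_of_forall_tensor_curve hR hX hC]
  refine ⟨fun h ↦ h 4 1 le_rfl (by omega) le_rfl (by omega), fun h i r hr h2 hi hw ↦ ?_⟩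
  obtain ⟨rfl, rfl⟩ : i = 4 ∧ r = 1 := by omega
  exact h

/-- **Fivefolds: granted the level-one fact and `HC` on all `X × C`, the amended conjecture for `X` in every bidegree
is `GHC(X, 4, 1) ∧ GHC(X, 5, 1)`.** [cite: GrothendieckTopology1969, pp. 300–301] [cite: Voisin2025, §4.3] -/
theorem forall_generalHodgePropertyFor_dim_five_iff_of_forall_tensor_curve (hR : levelOne_subHodge_eq_range_of_curve)
    (hX : IsSmoothProjective 5 X)
    (hC : ∀ ⦃C : Motives.SchemeOver ℂ⦄, IsSmoothProjective 1 C → HodgeConjectureFor (5 + 1) (X ⊗ C)) :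
    (∀ i r : ℕ, GeneralHodgePropertyFor 5 X i r) ↔
      GeneralHodgePropertyFor 5 X 4 1 ∧ GeneralHodgePropertyFor 5 X 5 1 := by
  rw [forall_generalHodgePropertyFor_iff_levelTwo_window_of_forall_tensor_curve hR hX hC]
  refine ⟨fun h ↦ ⟨h 4 1 le_rfl (by omega) (by omega) (by omega), h 5 1 le_rfl (by omega) le_rfl (by omega)⟩,
    fun h i r hr h2 hi hw ↦ ?_⟩
  rcases (show (i = 4 ∧ r = 1) ∨ (i = 5 ∧ r = 1) by omega) with ⟨rfl, rfl⟩ | ⟨rfl, rfl⟩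
  · exact h.1
  · exact h.2

/-! ### §4 `X × S` under the reduced level-one hypothesis -/

/-- **`X × S`, `S` a surface: `HC(X × S) ⟺ HC(X) ∧` the transcendental pieces `H^{2p−2}(X) ⊠ T(S)_ℂ`**, assuming only
the level-one cells `GHC(X, 2p+1, p)` with `1 ≤ p`, `2p + 1 ≤ dim X` (hard Lefschetz supplies the others;
`hodgeConjectureFor_tensor_surface_iff_transcendental_of_levelOne`). [cite: GrothendieckTopology1969, pp. 300–301]
[cite: Huybrechts2016K3, Ch. 3 §3.2–§3.3] [cite: Voisin2025, §4.3] [cite: Voisin2013GHCBloch, Lemma 2.1 (proof)] -/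
theorem hodgeConjectureFor_tensor_surface_iff_transcendental_of_levelOne_le {S : Motives.SchemeOver ℂ}
    (hX : IsSmoothProjective n X) (hS : IsSmoothProjective 2 S) (C : HodgeModel (n + 2) (X ⊗ S))
    (hL : ∀ p : ℕ, 1 ≤ p → 2 * p + 1 ≤ n → GeneralHodgePropertyFor n X (2 * p + 1) p) :
    HodgeConjectureFor (n + 2) (X ⊗ S) ↔
      HodgeConjectureFor n X ∧
        ∀ (p i : ℕ) (hk : i + 2 * 1 = 2 * p), 0 < i → i < 2 * n → (i - n) + 2 ≤ p →
          C.maxRatSubHodgeInFilt (2 * p) p ⊓ Submodule.map₂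
              ((cupProduct hk).compl₁₂ (complexBetti.map (fst X S) i).hom (complexBetti.map (snd X S) (2 * 1)).hom) ⊤
              (LinearMap.BilinForm.orthogonal
                (cupPairing (complexOrientationFamily hS) (show 2 * 1 + 2 * 1 = 2 * 2 by omega)) (algebraicClasses S 1)) ≤
            supportedClasses (X ⊗ S) (2 * p) p :=
  hodgeConjectureFor_tensor_surface_iff_transcendental_of_levelOne hX hS C
    (generalHodgePropertyFor_levelOne_of_forall_le hX hL)

/-! ### §5 `X × Y` under the level-one hypotheses of both factors -/

/-- **`HC(X × Y)` WHEN BOTH FACTORS SATISFY THEIR LEVEL-ONE CELLS**: if `GHC(X, 2p+1, p)` (`1 ≤ p`, `2p+1 ≤ dim X`)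
and `GHC(Y, 2p+1, p)` (`1 ≤ p`, `2p+1 ≤ dim Y`) hold, then `HC(X × Y) ⟺ HC(X) ∧ HC(Y) ∧` the Künneth pieces
`Hⁱ(X) ⊗ Hʲ(Y)` of `max(X × Y, 2p, p)` with `2 ≤ i ≤ 2 dim X − 2`, `2 ≤ j ≤ 2 dim Y − 2`, `(i − n)⁺ + (j − m)⁺ + 2 ≤ p` are
algebraic — the pieces with a factor `H¹` or `H^{2 dim − 1}` being settled by the level-one cells
(`MaxRationalSubHodgeStructureKunnethLevelOnePieces` §4), the border pieces by `HC` of the factors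
(`hodgeConjectureFor_tensor_iff_interior`). [cite: GrothendieckTopology1969, pp. 300–301]
[cite: VoisinHodgeI2002, §11.3.3 Thm. 11.38 and p. 286] [cite: Voisin2013GHCBloch, Lemma 2.1 (proof)]
[cite: Voisin2025, §4.3] -/
theorem hodgeConjectureFor_tensor_iff_interior_of_levelOne (hX : IsSmoothProjective n X) (hY : IsSmoothProjective m Y)
    (C : HodgeModel (n + m) (X ⊗ Y))
    (hLX : ∀ p : ℕ, 1 ≤ p → 2 * p + 1 ≤ n → GeneralHodgePropertyFor n X (2 * p + 1) p)
    (hLY : ∀ p : ℕ, 1 ≤ p → 2 * p + 1 ≤ m → GeneralHodgePropertyFor m Y (2 * p + 1) p) :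
    HodgeConjectureFor (n + m) (X ⊗ Y) ↔
      HodgeConjectureFor n X ∧ HodgeConjectureFor m Y ∧
        ∀ (p i j : ℕ) (hk : i + j = 2 * p), 2 ≤ i → i + 2 ≤ 2 * n → 2 ≤ j → j + 2 ≤ 2 * m →
          (i - n) + (j - m) + 2 ≤ p →
            C.maxRatSubHodgeInFilt (2 * p) p ⊓ kunnethPiece X Y hk ≤ supportedClasses (X ⊗ Y) (2 * p) p := by
  rw [hodgeConjectureFor_tensor_iff_interior hX hY C]
  refine ⟨fun ⟨hXc, hYc, hI⟩ ↦ ⟨hXc, hYc, fun p i j hk hi hin hj hjm hc ↦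
    hI p i j hk (by omega) (by omega) (by omega) (by omega) hc⟩, fun ⟨hXc, hYc, hI⟩ ↦ ⟨hXc, hYc, ?_⟩⟩
  intro p i j hk hi0 hin hj0 hjm hc
  have hGX := generalHodgePropertyFor_levelOne_of_forall_le hX hLX
  have hGY := generalHodgePropertyFor_levelOne_of_forall_le hY hLY
  -- the four families with a factor `H¹` or `H^{2 dim − 1}`
  by_cases hj1 : j = 1
  · subst hj1
    obtain ⟨c, rfl⟩ : ∃ c, p = c + 1 := ⟨p - 1, by omega⟩
    obtain rfl : i = 2 * c + 1 := by omega
    exact maxRatSubHodgeInFilt_inf_kunnethPiece_one_right_le_supportedClasses hX hY C hk rfl (hGX c)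
  by_cases hi1 : i = 1
  · subst hi1
    obtain ⟨c, rfl⟩ : ∃ c, p = c + 1 := ⟨p - 1, by omega⟩
    obtain rfl : j = 2 * c + 1 := by omega
    exact maxRatSubHodgeInFilt_inf_kunnethPiece_one_left_le_supportedClasses hX hY C hk rfl (hGY c)
  by_cases hjp : j + 1 = 2 * m
  · obtain ⟨c, rfl⟩ : ∃ c, p = c + m := ⟨p - m, by omega⟩
    obtain rfl : i = 2 * c + 1 := by omega
    exact maxRatSubHodgeInFilt_inf_kunnethPiece_penultimate_right_le_supportedClasses hX hY C hjp hk rfl (hGX c)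
  by_cases hip : i + 1 = 2 * n
  · obtain ⟨c, rfl⟩ : ∃ c, p = c + n := ⟨p - n, by omega⟩
    obtain rfl : j = 2 * c + 1 := by omega
    exact maxRatSubHodgeInFilt_inf_kunnethPiece_penultimate_left_le_supportedClasses hX hY C hip hk rfl (hGY c)
  · exact hI p i j hk (by omega) (by omega) (by omega) (by omega) hc

/-! ### §6 Surfaces with `p_g = 0`, of any irregularity -/

/-- **`HC(X) ∧` the level-one cells of `X` **`⟹ HC(X × S)` for every smooth projective surface `S` with
`H²(S) = NS(S)_ℂ`** (`p_g(S) = 0`; any irregularity: ruled surfaces over curves of any genus, bielliptic surfaces,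
…): then `T(S)_ℂ = NS(S)_ℂ^⊥ = 0` (`isCompl_algebraicClasses_orthogonal`) and the transcendental pieces of §4 vanish.
[cite: GrothendieckTopology1969, pp. 300–301] [cite: Huybrechts2016K3, Ch. 3 §3.2–§3.3]
[cite: VoisinHodgeI2002, §11.3.1 Thm. 11.30 and §11.3.3 Thm. 11.38] [cite: Voisin2013GHCBloch, Lemma 2.1 (proof)] -/
theorem hodgeConjectureFor_tensor_surface_of_levelOne_of_algebraicClasses_eq_top {S : Motives.SchemeOver ℂ}
    (hX : IsSmoothProjective n X) (hS : IsSmoothProjective 2 S) (hXc : HodgeConjectureFor n X)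
    (hL : ∀ p : ℕ, 1 ≤ p → 2 * p + 1 ≤ n → GeneralHodgePropertyFor n X (2 * p + 1) p)
    (hS2 : algebraicClasses S 1 = ⊤) : HodgeConjectureFor (n + 2) (X ⊗ S) := by
  classical
  obtain ⟨C⟩ := nonempty_hodgeModel_holds (hX.tensor_holds hS)
  have hT : LinearMap.BilinForm.orthogonal
      (cupPairing (complexOrientationFamily hS) (show 2 * 1 + 2 * 1 = 2 * 2 by omega)) (algebraicClasses S 1) = ⊥ := by
    have hc := (isCompl_algebraicClasses_orthogonal hS).inf_eq_bot
    rw [hS2] at hc ⊢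
    rwa [top_inf_eq] at hc
  refine (hodgeConjectureFor_tensor_surface_iff_transcendental_of_levelOne_le hX hS C hL).2 ⟨hXc, ?_⟩
  intro p i hk _ _ _
  rw [hT, Submodule.map₂_bot_right, inf_bot_eq]
  exact bot_le

/-- **`p_g(S) = 0` read on a Hodge model (`h^{2,0}(S) = 0`)**: `HC(X) ∧` the level-one cells of `X` `⟹ HC(X × S)`
(Lefschetz `(1,1)`: `NS(S)_ℂ = H²(S)`, `algebraicClasses_one_eq_top_of_hodgePQ_two_zero`).
[cite: GrothendieckTopology1969, pp. 300–301] [cite: VoisinHodgeI2002, §11.3.1 Thm. 11.30] -/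
theorem hodgeConjectureFor_tensor_surface_of_levelOne_of_hodgePQ_two_zero {S : Motives.SchemeOver ℂ}
    (hX : IsSmoothProjective n X) (hS : IsSmoothProjective 2 S) (hXc : HodgeConjectureFor n X)
    (hL : ∀ p : ℕ, 1 ≤ p → 2 * p + 1 ≤ n → GeneralHodgePropertyFor n X (2 * p + 1) p)
    (h20 : ∃ B : HodgeModel 2 S, Module.finrank ℂ ↥(B.hodgePQ 2 2 0) = 0) : HodgeConjectureFor (n + 2) (X ⊗ S) :=
  hodgeConjectureFor_tensor_surface_of_levelOne_of_algebraicClasses_eq_top hX hS hXc hL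
    (algebraicClasses_one_eq_top_of_hodgePQ_two_zero hS h20)

/-- **THREEFOLDS: `GHC(X, 3, 1) ⟹ HC(X × S)` for every smooth projective surface `S` with `H²(S) = NS(S)_ℂ`**
(`p_g(S) = 0`, any irregularity) — the odd piece `H³(X) ⊗ H¹(S)` of `max(X × S, 4, 2)` is the only obstruction
(`hodgeConjectureFor_threefold_tensor_surface_iff_odd_of_algebraicClasses_eq_top`) and `GHC(X, 3, 1)` settles it.
[cite: GrothendieckTopology1969, p. 301] [cite: VoisinHodgeI2002, §11.3.1 Thm. 11.30 and §11.3.3 Thm. 11.38]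
[cite: Voisin2013GHCBloch, Lemma 2.1 (proof)] -/
theorem hodgeConjectureFor_threefold_tensor_surface_of_three_one_of_algebraicClasses_eq_top {S : Motives.SchemeOver ℂ}
    (hX : IsSmoothProjective 3 X) (hS : IsSmoothProjective 2 S) (hG : GeneralHodgePropertyFor 3 X 3 1)
    (hS2 : algebraicClasses S 1 = ⊤) : HodgeConjectureFor (3 + 2) (X ⊗ S) := by
  classical
  obtain ⟨C⟩ := nonempty_hodgeModel_holds (hX.tensor_holds hS)
  exact (hodgeConjectureFor_threefold_tensor_surface_iff_odd_of_algebraicClasses_eq_top hX hS C hS2).2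
    (maxRatSubHodgeInFilt_inf_kunnethPiece_one_right_le_supportedClasses hX hS C _ (show 1 + 1 = 2 from rfl) hG)

/-- **Threefolds, `p_g(S) = 0` on a Hodge model**: `GHC(X, 3, 1) ⟹ HC(X × S)`.
[cite: GrothendieckTopology1969, p. 301] [cite: VoisinHodgeI2002, §11.3.1 Thm. 11.30] -/
theorem hodgeConjectureFor_threefold_tensor_surface_of_three_one_of_hodgePQ_two_zero {S : Motives.SchemeOver ℂ}
    (hX : IsSmoothProjective 3 X) (hS : IsSmoothProjective 2 S) (hG : GeneralHodgePropertyFor 3 X 3 1)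
    (h20 : ∃ B : HodgeModel 2 S, Module.finrank ℂ ↥(B.hodgePQ 2 2 0) = 0) : HodgeConjectureFor (3 + 2) (X ⊗ S) :=
  hodgeConjectureFor_threefold_tensor_surface_of_three_one_of_algebraicClasses_eq_top hX hS hG
    (algebraicClasses_one_eq_top_of_hodgePQ_two_zero hS h20)

/-! ### §7 Threefolds with `H³(X, ℚ)` irreducible and `h^{3,0} ≠ 0` -/

/-- **A THREEFOLD `X` WITH `H³(X, ℚ)` AN IRREDUCIBLE HODGE STRUCTURE AND `h^{3,0}(X) ≠ 0` SATISFIES `HC(X × C)` FOR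
EVERY SMOOTH PROJECTIVE CURVE `C`** (unconditionally): `J³(X)_alg = 0` (Voisin I Thm. 12.21), so `GHC(X, 3, 1)` holds
(the tree's `forall_generalHodgePropertyFor_dim_three_of_isIrreducible`), and `GHC(X, 3, 1) ⟹ HC(X × C)`
(`hodgeConjectureFor_threefold_tensor_curve_of_generalHodgePropertyFor_three_one`). The Hodge structure is read in
the Betti universe of a real Hodge model `hHD` (e.g. `exists_isReal_hodgeModel_holds`). (The very general quintic
threefold has `H³` irreducible and `h^{3,0} = 1`; irreducibility is the hypothesis here, not a theorem of the tree.)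
[cite: VoisinHodgeI2002, §12.2.2 Thm. 12.21] [cite: GrothendieckTopology1969, p. 301] [cite: MurreTorino1994, §5.8.3]
[cite: Voisin2013GHCBloch, Lemma 2.1 (proof)] -/
theorem hodgeConjectureFor_threefold_tensor_curve_of_isIrreducible (hHD : exists_isReal_hodgeModel)
    (hX : IsSmoothProjective 3 X) (hC : IsSmoothProjective 1 Y)
    (hirr : (BettiUniverse.hodge hHD hX 3).IsIrreducible) (hne : (BettiUniverse.hodge hHD hX 3).hodgeNumber 3 0 ≠ 0) :
    HodgeConjectureFor (3 + 1) (X ⊗ Y) :=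
  hodgeConjectureFor_threefold_tensor_curve_of_generalHodgePropertyFor_three_one hX hC
    (forall_generalHodgePropertyFor_dim_three_of_isIrreducible hHD hX hirr hne 3 1)

/-- **The same threefolds times a surface with `p_g = 0`: `HC(X × S)`.**
[cite: VoisinHodgeI2002, §12.2.2 Thm. 12.21 and §11.3.1 Thm. 11.30] [cite: GrothendieckTopology1969, p. 301]
[cite: Voisin2013GHCBloch, Lemma 2.1 (proof)] -/
theorem hodgeConjectureFor_threefold_tensor_surface_of_isIrreducible_of_algebraicClasses_eq_top
    {S : Motives.SchemeOver ℂ} (hHD : exists_isReal_hodgeModel) (hX : IsSmoothProjective 3 X)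
    (hS : IsSmoothProjective 2 S) (hirr : (BettiUniverse.hodge hHD hX 3).IsIrreducible)
    (hne : (BettiUniverse.hodge hHD hX 3).hodgeNumber 3 0 ≠ 0) (hS2 : algebraicClasses S 1 = ⊤) :
    HodgeConjectureFor (3 + 2) (X ⊗ S) :=
  hodgeConjectureFor_threefold_tensor_surface_of_three_one_of_algebraicClasses_eq_top hX hS
    (forall_generalHodgePropertyFor_dim_three_of_isIrreducible hHD hX hirr hne 3 1) hS2

end Literature.AlgebraicGeometry.HodgeTheory

end
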